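import Summits.ValiantsHypothesis.ValiantsHypothesis.Theorems.BarrierLeverChowCubeThetaHatPeelStep
import Summits.ValiantsHypothesis.ValiantsHypothesis.Theorems.BarrierLeverChowCubeCertificate

/-!
# Route BarrierLever — items 20195 / 20172: cube certificates, first unconditional class for all `h` —
# SELF-DUAL down-closed thin targets

Helper file (`--supports stmt-ValiantsHypothesis-20195`; cell valiant-natproofs, rung V4, 𝒟-side of
door (c); seat val-np-p2 gen 8).  Closes NO item; definition-free.  Runs the peeling calculus of
`…ChowCubeThetaHatPeel[Step]` to the end on one infinite class and feeds the result to the certificate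
`…ChowCubeCertificate.chow_hit_of_det_thetaHat_ne_zero`.

* `det_thetaHat_selfDual_ne_zero` — for EVERY `h` and every injective family `u` of sets of size `≤ 2`
  closed under removing elements (a graph together with its vertices and `∅`), the generic
  truncated-inverse matrix on rows `u` and columns `u ∘ σ` (`σ` any permutation) has `det Θ̂_X ≠ 0`.
  Proof: peel any vertex `c` with rule (P1) (`π = σ⁻¹`; rows and columns through `c` correspond),
  discharge the erased layout by rule (V), recurse on the vertex-deleted family — induction on the
  number of vertices.
* `chow_hit_of_chain_to_selfDual` — hence every layout `(u, w)` (rows `u` as above, `w` injective)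
  whose compression chain along all coordinates ends in a permutation of `u` is Chow-hit by `h + h`
  affine forms.  This is the dense-regime mechanism of the seat memo: e.g. for `u = ` all sets of
  size `≤ 2` (the full thin row family, `r = 1 + h + C(h,2)`) and `w = ` all sets of size `≥ h - 2`,
  the chain along `0, 1, …, h-1` ends in `u` (checked `h ≤ 9`; the family after `k` steps is
  `{W : |W ∖ [k]| - |W ∩ [k]| ≥ h - 2 - k}`), so «thin × co-thin» is certified at those heights; an
  all-`h` symbolic chain is left to a successor.

WHAT THIS IS NOT: a certificate class; items 20195 / 20172 / 19717 stay open; nothing on crux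
stmt-ValiantsHypothesis-14610 or on `VP` versus `VNP`.
-/

set_option linter.dupNamespace false

namespace Summit.ValiantsHypothesis.ValiantsHypothesis.Theorems.BarrierLever.ChowCube

open Finset MvPolynomial

variable {h : ℕ}

/-! ## 1. Self-dual down-closed thin families: `det Θ̂_X[u, u] ≠ 0` -/

/-- **Self-dual peeling.**  For an injective family `u` of sets of size `≤ 2` that is closed under
removing elements, `det Θ̂_X[u, u] ≠ 0` (induction on the number of vertices: rule (P1) with
`π = 1` at any vertex, rule (V) for the erased layout). -/
theorem det_thetaHat_selfDual_id_ne_zero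
    (Θ : Finset (Fin h) → Finset (Fin h) → MvPolynomial (Fin h × Fin h) ℂ)
    (hΘ : ∀ U S, Θ U S = coeff (∑ a ∈ (∅ : Finset (Fin h)), Finsupp.single (Fin.castAdd h a) 1 +
        ∑ c ∈ S, Finsupp.single (Fin.natAdd h c) 1)
      (∏ a ∈ U, ∑ S' ∈ (Finset.univ : Finset (Fin h)).powerset,
        monomial (∑ a' ∈ (∅ : Finset (Fin h)), Finsupp.single (Fin.castAdd h a') 1 +
          ∑ c ∈ S', Finsupp.single (Fin.natAdd h c) 1)
          ((-1 : MvPolynomial (Fin h × Fin h) ℂ) ^ S'.card *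
            (S'.card.factorial : MvPolynomial (Fin h × Fin h) ℂ) * ∏ c ∈ S', X (a, c)) :
            MvPolynomial (Fin (h + h)) (MvPolynomial (Fin h × Fin h) ℂ))) :
    ∀ (n : ℕ) {ι : Type} [Fintype ι] [DecidableEq ι] (u : ι → Finset (Fin h)),
      Function.Injective u → (∀ i, (u i).card ≤ 2) →
      (∀ i, ∀ c ∈ u i, ∃ i', u i' = (u i).erase c) →
      ((Finset.univ : Finset ι).biUnion u).card ≤ n →
      (Matrix.of fun i j => Θ (u i) (u j)).det ≠ 0 := by
  classical
  intro n
  induction n with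
  | zero =>
    intro ι _ _ u hu hcard hcl hn
    have hall : ∀ i, (u i).card ≤ 1 := by
      intro i
      have : u i ⊆ (Finset.univ : Finset ι).biUnion u :=
        Finset.subset_biUnion_of_mem u (Finset.mem_univ i)
      have h0 : ((Finset.univ : Finset ι).biUnion u) = ∅ := Finset.card_eq_zero.mp (Nat.le_zero.mp hn)
      rw [h0, Finset.subset_empty] at this
      rw [this, Finset.card_empty]
      exact Nat.zero_le _
    exact det_thetaHat_ne_zero_of_card_le_one Θ hΘ u u hu hu hall fun i hi => ⟨i, hi⟩
  | succ n ih =>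
    intro ι _ _ u hu hcard hcl hn
    by_cases hsmall : ∀ i, (u i).card ≤ 1
    · exact det_thetaHat_ne_zero_of_card_le_one Θ hΘ u u hu hu hsmall fun i hi => ⟨i, hi⟩
    push Not at hsmall
    obtain ⟨i₀, hi₀⟩ := hsmall
    obtain ⟨c, hc⟩ : (u i₀).Nonempty := Finset.card_pos.mp (by omega)
    -- peel `c` with `π = 1`
    refine det_thetaHat_ne_zero_of_peel Θ hΘ u u c (Equiv.refl ι) (fun i => Iff.rfl) ?_ ?_
    · -- restricted layout: induction hypothesis on the vertex-deleted family
      refine ih (fun i : {i // c ∉ u i} => u i) (fun i j e => Subtype.ext (hu e))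
        (fun i => hcard i) (fun i c' hc' => ?_) ?_
      · obtain ⟨i', hi'⟩ := hcl i c' hc'
        have hci' : c ∉ u i' := by
          rw [hi']
          exact fun hh => i.2 (Finset.mem_of_mem_erase hh)
        exact ⟨⟨i', hci'⟩, hi'⟩
      · have hsub : (Finset.univ : Finset {i // c ∉ u i}).biUnion (fun i : {i // c ∉ u i} => u i) ⊆
            ((Finset.univ : Finset ι).biUnion u).erase c := by
          intro x hx
          obtain ⟨i, -, hxi⟩ := Finset.mem_biUnion.mp hx
          refine Finset.mem_erase.mpr ⟨fun e => i.2 (e ▸ hxi), ?_⟩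
          exact Finset.mem_biUnion.mpr ⟨i, Finset.mem_univ _, hxi⟩
        have hcmem : c ∈ (Finset.univ : Finset ι).biUnion u :=
          Finset.mem_biUnion.mpr ⟨i₀, Finset.mem_univ _, hc⟩
        have := Finset.card_le_card hsub
        rw [Finset.card_erase_of_mem hcmem] at this
        omega
    · -- erased layout: rows of size `≤ 1`, rule (V)
      refine det_thetaHat_ne_zero_of_card_le_one Θ hΘ (fun i : {i // c ∈ u i} => (u i).erase c)
        (fun i : {i // c ∈ u i} => (u ((Equiv.refl ι) i)).erase c) ?_ ?_ (fun i => ?_) (fun i hi => ⟨i, hi⟩)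
      · intro i j e
        apply Subtype.ext
        apply hu
        rw [← Finset.insert_erase i.2, ← Finset.insert_erase j.2]
        exact congrArg _ e
      · intro i j e
        apply Subtype.ext
        apply hu
        rw [← Finset.insert_erase i.2, ← Finset.insert_erase j.2]
        exact congrArg _ e
      · have := Finset.card_erase_of_mem i.2
        have := hcard i
        omega

/-- **Self-dual targets, any column order.**  Same, with the columns permuted by `σ`. -/
theorem det_thetaHat_selfDual_ne_zero {ι : Type} [Fintype ι] [DecidableEq ι]
    (Θ : Finset (Fin h) → Finset (Fin h) → MvPolynomial (Fin h × Fin h) ℂ)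
    (hΘ : ∀ U S, Θ U S = coeff (∑ a ∈ (∅ : Finset (Fin h)), Finsupp.single (Fin.castAdd h a) 1 +
        ∑ c ∈ S, Finsupp.single (Fin.natAdd h c) 1)
      (∏ a ∈ U, ∑ S' ∈ (Finset.univ : Finset (Fin h)).powerset,
        monomial (∑ a' ∈ (∅ : Finset (Fin h)), Finsupp.single (Fin.castAdd h a') 1 +
          ∑ c ∈ S', Finsupp.single (Fin.natAdd h c) 1)
          ((-1 : MvPolynomial (Fin h × Fin h) ℂ) ^ S'.card *
            (S'.card.factorial : MvPolynomial (Fin h × Fin h) ℂ) * ∏ c ∈ S', X (a, c)) :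
            MvPolynomial (Fin (h + h)) (MvPolynomial (Fin h × Fin h) ℂ)))
    (u : ι → Finset (Fin h)) (hu : Function.Injective u) (hcard : ∀ i, (u i).card ≤ 2)
    (hcl : ∀ i, ∀ c ∈ u i, ∃ i', u i' = (u i).erase c) (σ : Equiv.Perm ι) :
    (Matrix.of fun i j => Θ (u i) (u (σ j))).det ≠ 0 := by
  classical
  have e : (Matrix.of fun i j => Θ (u i) (u (σ j))) = (Matrix.of fun i j => Θ (u i) (u j)).submatrix id σ := by
    ext i j
    rfl
  rw [e, Matrix.det_permute']
  exact mul_ne_zero (by simp)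
    (det_thetaHat_selfDual_id_ne_zero Θ hΘ _ u hu hcard hcl le_rfl)

/-! ## 2. Chow hits for layouts compressing to a self-dual target -/

/-- **Layouts whose columns compress to (a permutation of) the rows.**  Let `u : Fin r → Finset (Fin h)`
be injective, of sets of size `≤ 2`, closed under removing elements; let `w` be injective and let a
compression chain of `w` along a duplicate-free list exhausting the coordinates end in `u ∘ σ`.
Then `(u, w)` is Chow-hit by `h + h` affine forms. -/
theorem chow_hit_of_chain_to_selfDual {r : ℕ} (u w : Fin r → Finset (Fin h))
    (hu : Function.Injective u) (hcard : ∀ i, (u i).card ≤ 2)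
    (hcl : ∀ i, ∀ c ∈ u i, ∃ i', u i' = (u i).erase c) (hw : Function.Injective w)
    (L : List (Fin h)) (hL : L.Nodup) (hLall : ∀ c, c ∈ L)
    (ws : ℕ → (Fin r → Finset (Fin h))) (hws0 : ws 0 = w)
    (hstep : ∀ k (hk : k < L.length) j, ws (k + 1) j =
      if L[k] ∈ ws k j ∧ (∀ j', ws k j' ≠ (ws k j).erase L[k]) then (ws k j).erase L[k] else ws k j)
    (σ : Equiv.Perm (Fin r)) (hend : ∀ j, ws L.length j = u (σ j)) :
    ∃ ℓ : Fin (h + h) → MvPolynomial (Fin (h + h)) ℂ, (∀ k, (ℓ k).totalDegree ≤ 1) ∧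
      (Matrix.of fun i j : Fin r => coeff
        (∑ a ∈ u i, Finsupp.single (Fin.castAdd h a) 1 + ∑ c ∈ w j, Finsupp.single (Fin.natAdd h c) 1)
        (∏ k, ℓ k)).det ≠ 0 := by
  classical
  refine chow_hit_of_det_thetaHat_ne_zero u w hw L hL hLall ws hws0 hstep (fun U S =>
    coeff (∑ a ∈ (∅ : Finset (Fin h)), Finsupp.single (Fin.castAdd h a) 1 +
        ∑ c ∈ S, Finsupp.single (Fin.natAdd h c) 1)
      (∏ a ∈ U, ∑ S' ∈ (Finset.univ : Finset (Fin h)).powerset,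
        monomial (∑ a' ∈ (∅ : Finset (Fin h)), Finsupp.single (Fin.castAdd h a') 1 +
          ∑ c ∈ S', Finsupp.single (Fin.natAdd h c) 1)
          ((-1 : MvPolynomial (Fin h × Fin h) ℂ) ^ S'.card *
            (S'.card.factorial : MvPolynomial (Fin h × Fin h) ℂ) * ∏ c ∈ S', X (a, c)) :
            MvPolynomial (Fin (h + h)) (MvPolynomial (Fin h × Fin h) ℂ))) (fun _ _ => rfl) ?_
  have e : (Matrix.of fun i j : Fin r => coeff (∑ a ∈ (∅ : Finset (Fin h)), Finsupp.single (Fin.castAdd h a) 1 +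
        ∑ c ∈ ws L.length j, Finsupp.single (Fin.natAdd h c) 1)
      (∏ a ∈ u i, ∑ S' ∈ (Finset.univ : Finset (Fin h)).powerset,
        monomial (∑ a' ∈ (∅ : Finset (Fin h)), Finsupp.single (Fin.castAdd h a') 1 +
          ∑ c ∈ S', Finsupp.single (Fin.natAdd h c) 1)
          ((-1 : MvPolynomial (Fin h × Fin h) ℂ) ^ S'.card *
            (S'.card.factorial : MvPolynomial (Fin h × Fin h) ℂ) * ∏ c ∈ S', X (a, c)) :
            MvPolynomial (Fin (h + h)) (MvPolynomial (Fin h × Fin h) ℂ))) =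
      Matrix.of fun i j : Fin r => (fun U S => coeff (∑ a ∈ (∅ : Finset (Fin h)), Finsupp.single (Fin.castAdd h a) 1 +
        ∑ c ∈ S, Finsupp.single (Fin.natAdd h c) 1)
      (∏ a ∈ U, ∑ S' ∈ (Finset.univ : Finset (Fin h)).powerset,
        monomial (∑ a' ∈ (∅ : Finset (Fin h)), Finsupp.single (Fin.castAdd h a') 1 +
          ∑ c ∈ S', Finsupp.single (Fin.natAdd h c) 1)
          ((-1 : MvPolynomial (Fin h × Fin h) ℂ) ^ S'.card *
            (S'.card.factorial : MvPolynomial (Fin h × Fin h) ℂ) * ∏ c ∈ S', X (a, c)) :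
            MvPolynomial (Fin (h + h)) (MvPolynomial (Fin h × Fin h) ℂ))) (u i) (u (σ j)) := by
    ext i j
    rw [Matrix.of_apply, Matrix.of_apply, hend]
  rw [e]
  exact det_thetaHat_selfDual_ne_zero _ (fun _ _ => rfl) u hu hcard hcl σ

end Summit.ValiantsHypothesis.ValiantsHypothesis.Theorems.BarrierLever.ChowCube
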